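import Literature.NumberTheory.ComplexMultiplication.CMOrderWeakEquivalenceLocalIsomorphism
import HarnessLib

/-!
# Weak equivalence classes and extension (MARSEGLIA 2025 §6): inside its weak class an ideal can be moved so that
# its extension to an over-order `T` is ANY prescribed weakly equivalent `T`-ideal `J` (Lemma 6.1), and then
# `(R:T)·J ⊆ I ⊆ J` (Prop. 6.2); for `T = (𝔭:𝔭)`: `𝔭I = 𝔭J ⊆ I ⊆ J` (Thm. 6.3); and Lemma 6.5

Family `hodge`, lane `lit-hodgefound` (Track 2 foundations library; seat p15, row g26-#9), topic
`Literature/NumberTheory/ComplexMultiplication`, namespaces `Literature.NumberTheory.ComplexMultiplication.EndOrder`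
(§1, any order `𝔯 = endOrder ρ`) and `…CMTypeLattice` (§2, the order `𝔯 = endOrder (M_μ)`, where weak equivalence
`1 ∈ (I:J)(J:I)` is `I = L₀J` with `L₀ ∈ 𝓘(𝔯)` INVERTIBLE IN `𝔯` ITSELF —
`CMOrderWeakEquivalenceLocalIsomorphism.exists_isUnit_mul_eq_of_one_mem_div_mul_div`, g26-#3).  THEOREMS ONLY: no
definition, no instance, no named fact (net Literature debt `0`).  Vocabulary: `FractionalIdeal (endOrder ρ)⁰ K`,
`(I:J) = I / J`, the order is `1`, an over-order `T` is an idempotent `M = MM ≠ 0`, `(R:T) = 1 / M`, the extension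
`IT` is `I * M`, `(𝔭:𝔭) = ↑𝔭 / ↑𝔭`.

## Source, VERBATIM

S. Marseglia, *Local isomorphism classes of fractional ideals of orders in étale algebras*, J. Algebra 673 (2025)
77–102 [Marseglia2025LocalIsomorphism] (arXiv:2311.18571, held `paper:arxiv-2311.18571`, chunk p0011–p0012):
"Lemma 6.1. Let `𝒮` be a set of maximal ideals of `R`, `I₀` and `J` be fractional `R`-ideals and `T` be an
overorder of `R`. Assume that `I₀T` is `𝒮`-equivalent to `J`. Then there exists a fractional `R`-ideal `I` which is
weakly equivalent to `I₀` and satisfies `IT = J`.  Proof. … we produce a fractional `R`-ideal `L` satisfying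
`L_𝔭 = (αR)_𝔭` for every `𝔭 ∈ 𝒮₀` and `L_𝔮 = R_𝔮` for every `𝔮 ∉ 𝒮₀`. Set `I = I₀L`. Since `L` is a locally principal
fractional `R`-ideal, it is invertible. Hence, by Proposition 3.4?, `I` and `I₀` are weakly equivalent. … `IT = J`. □
Proposition 6.2. Let `R ⊆ T` be orders such that `R^tT` has multiplicator ring `T`. Put `𝔣 = (R:T)`. Let
`J₁, …, Jₙ` be representatives of `W̄(T)`. Let `I₀` be a fractional `R`-ideal with `(I₀:I₀) = R`. Then there exist a
unique index `i` and a fractional `R`-ideal `I` such that `I` is weakly equivalent to `I₀`, `IT = J_i`, and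
`𝔣J_i ⊆ I ⊆ J_i`.  Proof. … there exists a fractional `R`-ideal `I` weakly equivalent to `I₀` such that `IT = J_i`
… Now, `𝔣J_i ⊆ 𝔣IT ⊆ 𝔣I ⊆ I ⊆ J_i`, as required. □
Theorem 6.3. Let `R` be an order and `𝔭` be a maximal ideal of `R`. Put `T = (𝔭:𝔭)`. Let `J₁, …, Jₙ` be
representatives of `W̄(T)`. Let `I₀` be any fractional ideal with multiplicator ring `R`. Then there exist a
fractional `R`-ideal `I` and a unique index `i` such that `I` and `I₀` are weakly equivalent, `IT = J_i`, and
`𝔭I = 𝔭J_i ⊆ I ⊆ J_i`. Moreover, for such `I` … the natural inclusion `I ⊆ J_i` induces an inclusion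
`I/𝔭I ↪ J_i/𝔭J_i` of `R/𝔭`-vector spaces.  Proof. … `𝔣 = (R:(R:𝔭)) = 𝔭` … together with the observation that
`I ⊆ IT = J_i` implies `𝔭I = 𝔭J_i`. □
Lemma 6.5. Let `R ⊆ T` be orders and let `I` and `I′` be fractional `R`-ideals. Assume that `IT` has multiplicator
ring `T`. Then the following statements are equivalent: (1) `I` and `I′` are weakly equivalent, and `IT = I′T`.
(2) There exists a unique invertible fractional `R`-ideal `L` such that `I = I′L` and `LT = T`.  Proof. … we get
`IT = I′LT = IT·LT`. This implies that `LT ⊆ (IT:IT) = T`. … `L⁻¹T ⊆ T`. Hence, `T = L⁻¹T·LT ⊆ T`, that is, `LT = T`."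

In the weak-equivalence case (`𝒮` = all maximal ideals, the case used by Prop. 6.2 / Thm. 6.3) the local
construction of `L` in Lemma 6.1 is exactly what `CMOrderWeakEquivalenceLocalIsomorphism` already packages as
«`1 ∈ (J : I₀T)(I₀T : J) ⟹ J = L₀·I₀T` with `L₀ ∈ 𝓘(𝔯)`»; so `I = L₀I₀` — a genuinely shorter road, taken here.
The lists `J₁, …, Jₙ` of representatives are replaced by «any `J` weakly equivalent to `I₀T`» (the index `i` is then
the class of `I₀T`, which lies in `W̄(T)` by `CMOrderMultiplicatorRingExtension.mul_div_mul_eq_of_one_div_one_div_eq`,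
Prop. 5.1/5.2); the «inclusion `I/𝔭I ↪ J/𝔭J`» is recorded as the pair `I ⊆ J`, `𝔭I = 𝔭J` that induces it.

## What is formalised

* §1 (`𝔯 = endOrder ρ`): `mul_one_div_eq_of_mul_self_eq` (`T·(R:T) = (R:T)`), `one_div_le_one_of_one_le`
  (`(R:T) ⊆ R`), `le_mul_of_one_le` (`I ⊆ IT`), `coeIdeal_mul_div_self_eq` (`𝔭·(𝔭:𝔭) = 𝔭`),
  `coeIdeal_le_one_div_div_self` (`𝔭 ⊆ (R:(𝔭:𝔭))`).
* §2 (`𝔯 = endOrder (M_μ)`): **`exists_isUnit_mul_mul_eq_of_one_mem`** (LEMMA 6.1, weak case: `I = L₀I₀`, `IT = J`),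
  **`exists_one_div_mul_le_of_one_mem`** (PROP. 6.2: moreover `(R:T)J ⊆ I ⊆ J`),
  **`exists_coeIdeal_mul_le_of_one_mem`** (THM. 6.3: `T = (𝔭:𝔭)`, `𝔭J ⊆ I ⊆ J`, `𝔭I = 𝔭J`),
  **`exists_isUnit_mul_eq_and_mul_eq`** (LEMMA 6.5 (1) ⟹ (2), existence) and `one_mem_and_mul_eq_of_isUnit`
  (LEMMA 6.5 (2) ⟹ (1)).
-/

noncomputable section

open scoped nonZeroDivisors NumberField
open NumberField Module FractionalIdeal

namespace Literature.NumberTheory.ComplexMultiplication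

/-! ## §1 Every order `𝔯 = endOrder ρ`: the conductor `(R:T)` of an over-order, `𝔭(𝔭:𝔭) = 𝔭` -/

namespace EndOrder

variable {K : Type} [Field K] [NumberField K]
variable {ι : Type} [Fintype ι] [DecidableEq ι] [Nonempty ι] {ρ : K →ₐ[ℚ] Matrix ι ι ℚ}
variable [IsFractionRing (endOrder ρ) K]

/-- **`T·(R:T) = (R:T)`**: the conductor `(R:T) = 1 / M` of an over-order `T = M = MM` is a `T`-ideal («as
`𝔣T = 𝔣`»). [cite: Marseglia2019, §5, proof of Prop. 5.1 («as `𝔣T = 𝔣` we get …»), p. 10]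
[cite: Marseglia2025LocalIsomorphism, §6, proof of Prop. 6.2 («`𝔣J_i ⊆ 𝔣IT ⊆ 𝔣I`»), p. 11] -/
theorem mul_one_div_eq_of_mul_self_eq {M : FractionalIdeal (endOrder ρ)⁰ K} (hMM : M * M = M) (hM0 : M ≠ 0) :
    M * (1 / M) = 1 / M := by
  refine le_antisymm (FractionalIdeal.mul_le.2 fun x hx y hy ↦ ?_) fun y hy ↦ ?_
  · rw [mem_div_iff_of_ne_zero hM0] at hy ⊢
    intro z hz
    rw [mul_assoc, mul_left_comm]
    exact hy _ (hMM.le (mul_mem_mul hx hz))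
  · rw [← one_mul y]
    exact mul_mem_mul (FractionalIdeal.one_le.1 (one_le_of_mul_self_eq hMM hM0)) hy

omit [Nonempty ι] in
/-- **`(R:T) ⊆ R`** for `T ∋ 1`. [cite: Marseglia2025LocalIsomorphism, §6 Prop. 6.2 («Put `𝔣 = (R:T)`» — an ideal
of `R`), p. 11] -/
theorem one_div_le_one_of_one_le {M : FractionalIdeal (endOrder ρ)⁰ K} (h1 : 1 ≤ M) (hM0 : M ≠ 0) :
    (1 : FractionalIdeal (endOrder ρ)⁰ K) / M ≤ 1 := fun x hx ↦ by
  have h := (mem_div_iff_of_ne_zero hM0).1 hx 1 (FractionalIdeal.one_le.1 h1)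
  rwa [mul_one] at h

omit [Nonempty ι] [IsFractionRing (endOrder ρ) K] in
/-- **`I ⊆ IT`** for `T ∋ 1`. [cite: Marseglia2025LocalIsomorphism, §6, proof of Prop. 6.2 («`I ⊆ J_i`») and of
Thm. 6.3 («`I ⊆ IT = J_i`»), p. 11] -/
theorem le_mul_of_one_le {M : FractionalIdeal (endOrder ρ)⁰ K} (h1 : 1 ≤ M) (I : FractionalIdeal (endOrder ρ)⁰ K) :
    I ≤ I * M := fun x hx ↦ by
  rw [← mul_one x]
  exact mul_mem_mul hx (FractionalIdeal.one_le.1 h1)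

omit [Nonempty ι] in
/-- **`𝔭·(𝔭:𝔭) = 𝔭`** (any nonzero `N`: `N(N:N) = N`). [cite: Marseglia2025LocalIsomorphism, §6, proof of Thm. 6.3
(«`I ⊆ IT = J_i` implies `𝔭I = 𝔭J_i`», with `𝔭T = 𝔭` for `T = (𝔭:𝔭)`), p. 11] -/
theorem mul_div_self_eq_self {N : FractionalIdeal (endOrder ρ)⁰ K} (hN0 : N ≠ 0) : N * (N / N) = N := by
  rw [mul_comm, div_self_mul_self_eq hN0]

omit [Nonempty ι] in
/-- **`𝔭 ⊆ (R:(𝔭:𝔭))`** for an ideal `𝔭` of the order: `𝔭·(𝔭:𝔭) = 𝔭 ⊆ R` (with equality `(R:(𝔭:𝔭)) = 𝔭` when `𝔭`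
is a singular maximal ideal, `CMOrderMultiplicatorRingExtension`). [cite: Marseglia2025LocalIsomorphism, §6, proof of
Thm. 6.3 («`𝔣 = (R:(R:𝔭)) = 𝔭`»), p. 11] -/
theorem coeIdeal_le_one_div_div_self {𝔭 : Ideal (endOrder ρ)} (h0 : 𝔭 ≠ ⊥) :
    (𝔭 : FractionalIdeal (endOrder ρ)⁰ K) ≤ 1 / ((𝔭 : FractionalIdeal (endOrder ρ)⁰ K) / 𝔭) := by
  have hP0 : (𝔭 : FractionalIdeal (endOrder ρ)⁰ K) ≠ 0 := coeIdeal_ne_zero.2 h0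
  refine (le_div_iff_mul_le (div_self_ne_zero hP0)).2 ?_
  rw [mul_div_self_eq_self hP0]
  exact coeIdeal_le_one

end EndOrder

/-! ## §2 The order `𝔯 = endOrder (M_μ)`: Lemma 6.1, Proposition 6.2, Theorem 6.3, Lemma 6.5 -/

namespace CMTypeLattice

variable {K : Type} [Field K] [NumberField K]
variable {ι : Type} [Fintype ι] [DecidableEq ι] [Nonempty ι] (μ : Basis ι ℚ K)
variable [IsFractionRing (endOrder (Algebra.leftMulMatrix μ)) K]

/-- **LEMMA 6.1 (weak-equivalence case): if `I₀T` is weakly equivalent to `J`, some `I = L₀I₀` weakly equivalent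
to `I₀` — indeed with `L₀ ∈ 𝓘(𝔯)` invertible — has extension `IT = J`** (`T = M` any fractional ideal here; the
printed `L` «locally principal, hence invertible» is the `L₀` of `CMOrderWeakEquivalenceLocalIsomorphism`).
[cite: Marseglia2025LocalIsomorphism, §6 Lemma 6.1, p. 11] [cite: Marseglia2019, §4 Prop. 4.1 ((2) ⟹ (3) ⟹ (1)),
p. 8] -/
theorem exists_isUnit_mul_mul_eq_of_one_mem {I₀ J M : FractionalIdeal (endOrder (Algebra.leftMulMatrix μ))⁰ K}
    (hI₀ : I₀ ≠ 0) (hI₀M : I₀ * M ≠ 0) (hJ : J ≠ 0) (h1 : (1 : K) ∈ J / (I₀ * M) * (I₀ * M / J)) :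
    ∃ L₀ : FractionalIdeal (endOrder (Algebra.leftMulMatrix μ))⁰ K, IsUnit L₀ ∧
      (1 : K) ∈ L₀ * I₀ / I₀ * (I₀ / (L₀ * I₀)) ∧ L₀ * I₀ * M = J := by
  obtain ⟨L₀, hL₀, h⟩ := exists_isUnit_mul_eq_of_one_mem_div_mul_div μ hJ hI₀M h1
  have hL₀I₀ : L₀ * I₀ ≠ 0 := EndOrder.fractionalIdeal_mul_ne_zero hL₀.ne_zero hI₀
  exact ⟨L₀, hL₀, NumberRing.one_mem_div_mul_div_of_isUnit_mul_eq hL₀I₀ hI₀ hL₀ rfl, by rw [mul_assoc, h]⟩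

/-- **PROPOSITION 6.2: for an over-order `T = M` with conductor `𝔣 = (R:T)` and any `J` weakly equivalent to `I₀T`,
there is `I = L₀I₀` (`L₀ ∈ 𝓘(𝔯)`) weakly equivalent to `I₀` with `IT = J` and `𝔣J ⊆ I ⊆ J`** («`𝔣J_i ⊆ 𝔣IT ⊆ 𝔣I ⊆
I ⊆ J_i`»; the class of `I₀T` lies in `W̄(T)` when `(I₀:I₀) = R` and `R^tT` has multiplicator ring `T`,
`CMOrderMultiplicatorRingExtension`). [cite: Marseglia2025LocalIsomorphism, §6 Prop. 6.2, p. 11] -/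
theorem exists_one_div_mul_le_of_one_mem {I₀ J M : FractionalIdeal (endOrder (Algebra.leftMulMatrix μ))⁰ K}
    (hMM : M * M = M) (hM0 : M ≠ 0) (hI₀ : I₀ ≠ 0) (hJ : J ≠ 0)
    (h1 : (1 : K) ∈ J / (I₀ * M) * (I₀ * M / J)) :
    ∃ I : FractionalIdeal (endOrder (Algebra.leftMulMatrix μ))⁰ K,
      (∃ L₀ : FractionalIdeal (endOrder (Algebra.leftMulMatrix μ))⁰ K, IsUnit L₀ ∧ I = L₀ * I₀) ∧
      (1 : K) ∈ I / I₀ * (I₀ / I) ∧ I * M = J ∧ 1 / M * J ≤ I ∧ I ≤ J := by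
  have h1M : 1 ≤ M := EndOrder.one_le_of_mul_self_eq hMM hM0
  have hI₀M : I₀ * M ≠ 0 := EndOrder.fractionalIdeal_mul_ne_zero hI₀ hM0
  obtain ⟨L₀, hL₀, hw, hIM⟩ := exists_isUnit_mul_mul_eq_of_one_mem μ hI₀ hI₀M hJ h1
  refine ⟨L₀ * I₀, ⟨L₀, hL₀, rfl⟩, hw, hIM, ?_, ?_⟩
  · -- `𝔣J = 𝔣IT = I(T𝔣) = I𝔣 ⊆ I`
    calc 1 / M * J = L₀ * I₀ * (M * (1 / M)) := by rw [← hIM]; ring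
      _ = L₀ * I₀ * (1 / M) := by rw [EndOrder.mul_one_div_eq_of_mul_self_eq hMM hM0]
      _ ≤ L₀ * I₀ * 1 := mul_le_mul' le_rfl (EndOrder.one_div_le_one_of_one_le h1M hM0)
      _ = L₀ * I₀ := mul_one _
  · rw [← hIM]
    exact EndOrder.le_mul_of_one_le h1M _

/-- **THEOREM 6.3: for a maximal ideal `𝔭` with multiplicator ring `T = (𝔭:𝔭)` and any `J` weakly equivalent to
`I₀T`, there is `I = L₀I₀` (`L₀ ∈ 𝓘(𝔯)`) weakly equivalent to `I₀` with `IT = J` and `𝔭J ⊆ I ⊆ J`, `𝔭I = 𝔭J`** (so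
`I/𝔭I ↪ J/𝔭J`; from Prop. 6.2 with `𝔭 ⊆ (R:(𝔭:𝔭))` and `𝔭T = 𝔭`). [cite: Marseglia2025LocalIsomorphism, §6
Thm. 6.3, p. 11] -/
theorem exists_coeIdeal_mul_le_of_one_mem (𝔭 : Ideal (endOrder (Algebra.leftMulMatrix μ))) [h𝔭 : 𝔭.IsMaximal]
    {I₀ J : FractionalIdeal (endOrder (Algebra.leftMulMatrix μ))⁰ K} (hI₀ : I₀ ≠ 0) (hJ : J ≠ 0)
    (h1 : (1 : K) ∈ J / (I₀ * ((𝔭 : FractionalIdeal (endOrder (Algebra.leftMulMatrix μ))⁰ K) / 𝔭)) *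
      (I₀ * ((𝔭 : FractionalIdeal (endOrder (Algebra.leftMulMatrix μ))⁰ K) / 𝔭) / J)) :
    ∃ I : FractionalIdeal (endOrder (Algebra.leftMulMatrix μ))⁰ K,
      (∃ L₀ : FractionalIdeal (endOrder (Algebra.leftMulMatrix μ))⁰ K, IsUnit L₀ ∧ I = L₀ * I₀) ∧
      (1 : K) ∈ I / I₀ * (I₀ / I) ∧ I * ((𝔭 : FractionalIdeal (endOrder (Algebra.leftMulMatrix μ))⁰ K) / 𝔭) = J ∧
      (𝔭 : FractionalIdeal (endOrder (Algebra.leftMulMatrix μ))⁰ K) * J ≤ I ∧ I ≤ J ∧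
      (𝔭 : FractionalIdeal (endOrder (Algebra.leftMulMatrix μ))⁰ K) * I = 𝔭 * J := by
  have h0 : 𝔭 ≠ ⊥ := Ring.ne_bot_of_isMaximal_of_not_isField h𝔭 EndOrder.not_isField
  have hP0 : (𝔭 : FractionalIdeal (endOrder (Algebra.leftMulMatrix μ))⁰ K) ≠ 0 := coeIdeal_ne_zero.2 h0
  have hT0 := EndOrder.div_self_ne_zero hP0
  obtain ⟨I, hL, hw, hIT, hfI, hIJ⟩ :=
    exists_one_div_mul_le_of_one_mem μ (EndOrder.div_self_mul_div_self hP0) hT0 hI₀ hJ h1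
  have h𝔭J : (𝔭 : FractionalIdeal (endOrder (Algebra.leftMulMatrix μ))⁰ K) * J ≤ I :=
    (mul_le_mul' (EndOrder.coeIdeal_le_one_div_div_self h0) le_rfl).trans hfI
  refine ⟨I, hL, hw, hIT, h𝔭J, hIJ, le_antisymm (mul_le_mul' le_rfl hIJ) ?_⟩
  -- `𝔭J = 𝔭IT = (𝔭T)I = 𝔭I`
  rw [← hIT, mul_left_comm, EndOrder.mul_div_self_eq_self hP0]
  exact le_of_eq (mul_comm _ _)

/-- **LEMMA 6.5, (1) ⟹ (2) (existence): if `IT` has multiplicator ring `T`, `I` and `I′` are weakly equivalent and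
`IT = I′T`, then `I = L₀I′` for some `L₀ ∈ 𝓘(𝔯)` with `L₀T = T`** («`IT = I′LT = IT·LT` … `LT ⊆ (IT:IT) = T` …
`L⁻¹T ⊆ T` … `LT = T`»). [cite: Marseglia2025LocalIsomorphism, §6 Lemma 6.5 ((1) ⟹ (2)), pp. 11–12] -/
theorem exists_isUnit_mul_eq_and_mul_eq {I I' M : FractionalIdeal (endOrder (Algebra.leftMulMatrix μ))⁰ K}
    (hMM : M * M = M) (hM0 : M ≠ 0) (hI : I ≠ 0) (hI' : I' ≠ 0) (h1 : (1 : K) ∈ I / I' * (I' / I))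
    (hext : I * M = I' * M) (hT : I * M / (I * M) = M) :
    ∃ L₀ : FractionalIdeal (endOrder (Algebra.leftMulMatrix μ))⁰ K, IsUnit L₀ ∧ L₀ * I' = I ∧ L₀ * M = M := by
  obtain ⟨L₀, hL₀, h⟩ := exists_isUnit_mul_eq_of_one_mem_div_mul_div μ hI hI' h1
  have hIM0 : I * M ≠ 0 := EndOrder.fractionalIdeal_mul_ne_zero hI hM0
  have hLL : L₀ * L₀⁻¹ = 1 := (mul_inv_cancel_iff_isUnit K).2 hL₀
  refine ⟨L₀, hL₀, h, le_antisymm ?_ ?_⟩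
  · -- `L₀·IT = L₀I′T = IT`, so `L₀ ⊆ (IT:IT) = T` and `L₀T ⊆ TT = T`
    have hle : L₀ ≤ M := by
      rw [← hT]
      refine (le_div_iff_mul_le hIM0).2 (le_of_eq ?_)
      nth_rw 1 [hext]
      rw [← mul_assoc, h]
    calc L₀ * M ≤ M * M := mul_le_mul' hle le_rfl
      _ = M := hMM
  · -- `L₀⁻¹·I′T = L₀⁻¹IT = I′T`, so `L₀⁻¹ ⊆ T` and `T = L₀L₀⁻¹T ⊆ L₀T`
    have h' : L₀⁻¹ * I = I' := by rw [← h, ← mul_assoc, mul_comm L₀⁻¹, hLL, one_mul]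
    have hle : L₀⁻¹ ≤ M := by
      rw [← hT]
      refine (le_div_iff_mul_le hIM0).2 (le_of_eq ?_)
      rw [← mul_assoc, h', ← hext]
    calc M = L₀ * (L₀⁻¹ * M) := by rw [← mul_assoc, hLL, one_mul]
      _ ≤ L₀ * (M * M) := mul_le_mul' le_rfl (mul_le_mul' hle le_rfl)
      _ = L₀ * M := by rw [hMM]

omit [Nonempty ι] in
/-- **LEMMA 6.5, (2) ⟹ (1) («clear»): `I = L₀I′` with `L₀ ∈ 𝓘(𝔯)`, `L₀T = T` ⟹ `I`, `I′` weakly equivalent and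
`IT = I′T`.** [cite: Marseglia2025LocalIsomorphism, §6 Lemma 6.5 ((2) ⟹ (1)), pp. 11–12] -/
theorem one_mem_and_mul_eq_of_isUnit {I I' M L₀ : FractionalIdeal (endOrder (Algebra.leftMulMatrix μ))⁰ K}
    (hI : I ≠ 0) (hI' : I' ≠ 0) (hL₀ : IsUnit L₀) (h : L₀ * I' = I) (hLM : L₀ * M = M) :
    (1 : K) ∈ I / I' * (I' / I) ∧ I * M = I' * M :=
  ⟨NumberRing.one_mem_div_mul_div_of_isUnit_mul_eq hI hI' hL₀ h, by
    rw [← h, mul_comm L₀ I', mul_assoc, hLM]⟩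

end CMTypeLattice

end Literature.NumberTheory.ComplexMultiplication
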